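import Summits.RiemannHypothesis.RiemannHypothesis.Theorems.OddSectorOddOneSignedWindowsLayerDefs
import Summits.RiemannHypothesis.RiemannHypothesis.Theorems.OddSectorOddArchAnchorFold
import Literature.NumberTheory.LFunctions.WeilMarkovQuadratic
import HarnessLib

set_option linter.dupNamespace false

/-!
# Fatou lower bound for the archimedean gain (origin-layer line of `OddSector.OddOneSignedWindows`)

Stub `stub_archGainLiminf` of the line `Sketch` of crux item stmt-RiemannHypothesis-17778
(RH-free measure theory).

Along a sequence `gₙ → u` a.e., the "gain" of the folded-kernel inequality,
`2 ∫∫_{x,s>0} δ(gₙ(s), gₙ(x)) (k(|s−x|) − k(x+s)) ds dx` with `δ(A, B) = |A||B| − Re(A B̄) ≥ 0` and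
`k = weilArchDensity` (non-increasing on `(0, ∞)`, so the folded kernel `k(|s−x|) − k(x+s)` is
`≥ 0` off the diagonal), has `liminf ≥ ∫_{(0,η)} 8 w(x) G(x) dx`, where `w = Re (layerNegPart η u)`
is the negative part of `Re u` on the origin layer and `G = layerArchGlue a η u` is the archimedean
glue seen from the layer. Proof: shrink the quadrant to the rectangle `(0,η) × (η,a)` and its
mirror image (Tonelli symmetry of the integrand gives the factor `2`), apply Fatou's lemma in each
variable, identify the a.e. limit by continuity of `δ`, and evaluate `δ(u(s), u(x)) = 2 u(s) w(x)`
for real `u` with `u(s) ≥ 0` on the bulk; the remaining `s`-integral of the non-negative integrable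
function `u(s) (k(s−x) − k(x+s))` (an `L²` function against a kernel bounded by `k(η−x)` on a
bounded interval) is `ofReal` of the Bochner integral defining the glue.
-/

noncomputable section

open Complex Filter Set MeasureTheory
open scoped Real Topology ComplexConjugate ENNReal

namespace Summit.RiemannHypothesis.RiemannHypothesis.Theorems.OddSector

open Literature.NumberTheory.LFunctions

/-! ## The folded kernel on the rectangle `(0, η) × (η, a)` -/

/-- The folded kernel `k(|s − x|) − k(x + s)` is non-negative for `0 < x < s`. [folklore] -/
private theorem foldKernel_nonneg {x s : ℝ} (hx : 0 < x) (hxs : x < s) :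
    0 ≤ weilArchDensity |s - x| - weilArchDensity (x + s) := by
  rw [abs_of_pos (sub_pos.2 hxs), sub_nonneg]
  exact weilArchDensity_antitoneOn (mem_Ioi.2 (sub_pos.2 hxs)) (mem_Ioi.2 (by linarith))
    (by linarith)

/-- The folded kernel is at most `k(η − x)` for `0 < x < η ≤ s`. [folklore] -/
private theorem foldKernel_le {x η s : ℝ} (hx : 0 < x) (hxη : x < η) (hηs : η ≤ s) :
    weilArchDensity |s - x| - weilArchDensity (x + s) ≤ weilArchDensity (η - x) := by
  rw [abs_of_pos (sub_pos.2 (hxη.trans_le hηs))]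
  have h1 : weilArchDensity (s - x) ≤ weilArchDensity (η - x) :=
    weilArchDensity_antitoneOn (mem_Ioi.2 (sub_pos.2 hxη)) (mem_Ioi.2 (by linarith)) (by linarith)
  linarith [(weilArchDensity_pos (by linarith : 0 < x + s)).le]

/-- The folded kernel is measurable in the pair `(x, s)`. [folklore] -/
private theorem measurable_foldKernel :
    Measurable fun p : ℝ × ℝ ↦ weilArchDensity |p.2 - p.1| - weilArchDensity (p.1 + p.2) :=
  (measurable_weilArchDensity.comp
    (continuous_abs.measurable.comp (measurable_snd.sub measurable_fst))).sub
    (measurable_weilArchDensity.comp (measurable_fst.add measurable_snd))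

/-! ## The gain integrand -/

/-- The gain integrand `(x, s) ↦ ofReal(δ(g s, g x) (k(|s−x|) − k(x+s)))` is measurable for
measurable `g`. [folklore] -/
private theorem measurable_gain {g : ℝ → ℂ} (hg : Measurable g) :
    Measurable (Function.uncurry fun x s : ℝ ↦ ENNReal.ofReal
      ((‖g s‖ * ‖g x‖ - (g s * conj (g x)).re) *
        (weilArchDensity |s - x| - weilArchDensity (x + s)))) := by
  refine ENNReal.measurable_ofReal.comp (Measurable.mul ?_ measurable_foldKernel)
  exact ((hg.comp measurable_snd).norm.mul (hg.comp measurable_fst).norm).sub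
    (Complex.measurable_re.comp ((hg.comp measurable_snd).mul
      (Complex.continuous_conj.measurable.comp (hg.comp measurable_fst))))

/-- The gain integrand is symmetric under `(x, s) ↦ (s, x)`. [folklore] -/
private theorem gain_symm (g : ℝ → ℂ) (x s : ℝ) :
    ENNReal.ofReal ((‖g x‖ * ‖g s‖ - (g x * conj (g s)).re) *
        (weilArchDensity |x - s| - weilArchDensity (s + x))) =
      ENNReal.ofReal ((‖g s‖ * ‖g x‖ - (g s * conj (g x)).re) *
        (weilArchDensity |s - x| - weilArchDensity (x + s))) := by
  have h : (g x * conj (g s)).re = (g s * conj (g x)).re := by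
    simp only [Complex.mul_re, Complex.conj_re, Complex.conj_im]
    ring
  rw [h, mul_comm ‖g x‖, abs_sub_comm, add_comm s x]

/-- The gain integrand is continuous in the two values: along `gₙ(x) → u(x)`, `gₙ(s) → u(s)` it
converges. [folklore] -/
private theorem tendsto_gain {g : ℕ → ℝ → ℂ} {u : ℝ → ℂ} {x s : ℝ}
    (hx : Tendsto (fun n ↦ g n x) atTop (𝓝 (u x))) (hs : Tendsto (fun n ↦ g n s) atTop (𝓝 (u s)))
    (K : ℝ) :
    Tendsto (fun n ↦ ENNReal.ofReal ((‖g n s‖ * ‖g n x‖ - (g n s * conj (g n x)).re) * K)) atTop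
      (𝓝 (ENNReal.ofReal ((‖u s‖ * ‖u x‖ - (u s * conj (u x)).re) * K))) := by
  have hc : Continuous fun p : ℂ × ℂ ↦
      ENNReal.ofReal ((‖p.1‖ * ‖p.2‖ - (p.1 * conj p.2).re) * K) :=
    ENNReal.continuous_ofReal.comp ((((continuous_norm.comp continuous_fst).mul
      (continuous_norm.comp continuous_snd)).sub (Complex.continuous_re.comp
        (continuous_fst.mul (Complex.continuous_conj.comp continuous_snd)))).mul continuous_const)
  have h := (hc.tendsto (u s, u x)).comp (hs.prodMk_nhds hx)
  exact h

/-- For real values `A ≥ 0` and `B`: `|A||B| − Re(A B̄) = 2 A B⁻`. [folklore] -/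
private theorem delta_real {A B : ℂ} (hAi : A.im = 0) (hBi : B.im = 0) (hA : 0 ≤ A.re) :
    ‖A‖ * ‖B‖ - (A * conj B).re = 2 * A.re * max (-B.re) 0 := by
  obtain ⟨a', rfl⟩ : ∃ a' : ℝ, A = a' := ⟨A.re, Complex.ext (by simp) (by simp [hAi])⟩
  obtain ⟨b', rfl⟩ : ∃ b' : ℝ, B = b' := ⟨B.re, Complex.ext (by simp) (by simp [hBi])⟩
  simp only [Complex.ofReal_re] at hA ⊢
  rw [Complex.conj_ofReal, ← Complex.ofReal_mul, Complex.ofReal_re, Complex.norm_real,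
    Complex.norm_real, Real.norm_eq_abs, Real.norm_eq_abs, abs_of_nonneg hA]
  rcases le_total 0 b' with hb | hb
  · rw [abs_of_nonneg hb, max_eq_right (neg_nonpos.2 hb)]
    ring
  · rw [abs_of_nonpos hb, max_eq_left (neg_nonneg.2 hb)]
    ring

/-! ## Rectangles inside the quadrant -/

/-- **Two rectangles inside the quadrant.** For a measurable symmetric `G ≥ 0` and `0 < η`,
`∫_{x ∈ (0,η)} ∫_{s ∈ (η,a)} (G + G) ≤ ∫_{x>0} ∫_{s>0} G`: the rectangle `(0,η) × (η,a)` and its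
mirror image `(η,a) × (0,η)` are disjoint subsets of the quadrant, and carry the same mass by
Tonelli and the symmetry of `G`. [folklore] -/
private theorem setLIntegral_rect_add_le {G : ℝ → ℝ → ℝ≥0∞} (hG : Measurable (Function.uncurry G))
    (hsymm : ∀ x s, G s x = G x s) {η : ℝ} (a : ℝ) (hη : 0 < η) :
    ∫⁻ x in Ioo 0 η, ∫⁻ s in Ioo η a, (G x s + G x s) ≤
      ∫⁻ x in Ioi (0 : ℝ), ∫⁻ s in Ioi (0 : ℝ), G x s := by
  have hmx : ∀ x, Measurable (G x) := fun x ↦ hG.comp measurable_prodMk_left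
  have hIx : Measurable fun x ↦ ∫⁻ s in Ioo η a, G x s :=
    hG.lintegral_prod_right' (ν := volume.restrict (Ioo η a))
  have hsub : Ioo 0 η ∪ Ioo η a ⊆ Ioi 0 :=
    union_subset Ioo_subset_Ioi_self fun s hs ↦ mem_Ioi.2 (hη.trans hs.1)
  have hdisj : Disjoint (Ioo 0 η) (Ioo η a) :=
    disjoint_left.2 fun x hx hx' ↦ lt_asymm hx.2 hx'.1
  have h1 : Ioo η a ⊆ Ioi 0 := fun s hs ↦ mem_Ioi.2 (hη.trans hs.1)
  calc ∫⁻ x in Ioo 0 η, ∫⁻ s in Ioo η a, (G x s + G x s)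
      = ∫⁻ x in Ioo 0 η, ((∫⁻ s in Ioo η a, G x s) + ∫⁻ s in Ioo η a, G x s) :=
        lintegral_congr fun x ↦ lintegral_add_left (hmx x) _
    _ = (∫⁻ x in Ioo 0 η, ∫⁻ s in Ioo η a, G x s) + ∫⁻ x in Ioo 0 η, ∫⁻ s in Ioo η a, G x s :=
        lintegral_add_left hIx _
    _ = (∫⁻ x in Ioo 0 η, ∫⁻ s in Ioo η a, G x s) +
          ∫⁻ x in Ioo η a, ∫⁻ s in Ioo 0 η, G x s := by
        congr 1
        rw [lintegral_lintegral_swap hG.aemeasurable]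
        exact lintegral_congr fun x ↦ lintegral_congr fun s ↦ hsymm x s
    _ ≤ (∫⁻ x in Ioo 0 η, ∫⁻ s in Ioi (0 : ℝ), G x s) +
          ∫⁻ x in Ioo η a, ∫⁻ s in Ioi (0 : ℝ), G x s :=
        add_le_add (lintegral_mono fun x ↦ lintegral_mono_set h1)
          (lintegral_mono fun x ↦ lintegral_mono_set Ioo_subset_Ioi_self)
    _ = ∫⁻ x in Ioo 0 η ∪ Ioo η a, ∫⁻ s in Ioi (0 : ℝ), G x s :=
        (lintegral_union measurableSet_Ioo hdisj).symm
    _ ≤ ∫⁻ x in Ioi (0 : ℝ), ∫⁻ s in Ioi (0 : ℝ), G x s := lintegral_mono_set hsub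

/-! ## The inner integral on the bulk -/

/-- For a layer point `x ∈ (0, η)` and `u ∈ L²` with `Re u ≥ 0` a.e. on `[η, a)`, the lower
Lebesgue integral `∫_{s ∈ (η,a)} ofReal(Re u(s) (k(|s−x|) − k(x+s))) ds` is `ofReal` of the
archimedean glue `layerArchGlue a η u x` (the integrand is a.e. non-negative and integrable: an
`L²` function on a bounded interval against a kernel bounded by `k(η − x)`). [folklore] -/
private theorem setLIntegral_bulk_eq_glue {a η : ℝ} {u : ℝ → ℂ} (hu : MemLp u 2 volume)
    (hsign : ∀ᵐ t : ℝ, t ∈ Ico η a → 0 ≤ (u t).re) {x : ℝ} (hx : x ∈ Ioo 0 η) :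
    ∫⁻ s in Ioo η a, ENNReal.ofReal
        ((u s).re * (weilArchDensity |s - x| - weilArchDensity (x + s))) =
      ENNReal.ofReal (layerArchGlue a η u x) := by
  have hI : Integrable u (volume.restrict (Ioo η a)) := (hu.restrict _).integrable one_le_two
  have hMm : Measurable fun s ↦ weilArchDensity |s - x| - weilArchDensity (x + s) :=
    measurable_foldKernel.comp measurable_prodMk_left
  have hint : Integrable (fun s ↦ (u s).re * (weilArchDensity |s - x| - weilArchDensity (x + s)))
      (volume.restrict (Ioo η a)) := by
    refine Integrable.mono' (hI.norm.mul_const (weilArchDensity (η - x))) ?_ ?_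
    · exact (Complex.continuous_re.comp_aestronglyMeasurable hI.aestronglyMeasurable).mul
        hMm.aestronglyMeasurable
    · filter_upwards [ae_restrict_mem measurableSet_Ioo] with s hs
      rw [Real.norm_eq_abs, abs_mul, abs_of_nonneg (foldKernel_nonneg hx.1 (hx.2.trans hs.1))]
      exact mul_le_mul (Complex.abs_re_le_norm _) (foldKernel_le hx.1 hx.2 hs.1.le)
        (foldKernel_nonneg hx.1 (hx.2.trans hs.1)) (norm_nonneg _)
  have hnn : 0 ≤ᵐ[volume.restrict (Ioo η a)]
      fun s ↦ (u s).re * (weilArchDensity |s - x| - weilArchDensity (x + s)) := by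
    filter_upwards [ae_restrict_mem measurableSet_Ioo, ae_restrict_of_ae hsign] with s hs hsg
    exact mul_nonneg (hsg (Ioo_subset_Ico_self hs)) (foldKernel_nonneg hx.1 (hx.2.trans hs.1))
  have hglue : layerArchGlue a η u x =
      ∫ s in Ioo η a, (u s).re * (weilArchDensity |s - x| - weilArchDensity (x + s)) := by
    unfold layerArchGlue
    congr 1
    funext y
    rw [abs_sub_comm]
  rw [hglue, ofReal_integral_eq_lintegral_ofReal hint hnn]

/-! ## The stub -/

/-- **Fatou lower bound for the archimedean gain (RH-free).** Let `0 < η < a`, let `u ∈ L²(ℝ)` be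
real, vanish a.e. off `[-a, a]`, and have `Re u ≥ 0` a.e. on the bulk `[η, a)`, and let `gₙ` be
measurable with `gₙ → u` a.e. Then the gain of the folded-kernel inequality along `gₙ`,
`2 ∫∫_{x,s>0} (|gₙ(s)||gₙ(x)| − Re(gₙ(s) conj gₙ(x))) (k(|s−x|) − k(x+s)) ds dx`
(`k = weilArchDensity`), has `liminf` at least `∫_{(0,η)} 8 w(x) G(x) dx`, `w` the layer negative
part of `u` and `G = layerArchGlue a η u` the archimedean glue (both sides as lower Lebesgue
integrals). [folklore] -/
theorem stub_archGainLiminf :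
    ∀ (a η : ℝ) (u : ℝ → ℂ) (g : ℕ → ℝ → ℂ), 0 < η → η < a →
      MemLp u 2 volume → (∀ t, (u t).im = 0) → (∀ᵐ t : ℝ, t ∉ Icc (-a) a → u t = 0) →
      (∀ᵐ t : ℝ, t ∈ Ico η a → 0 ≤ (u t).re) →
      (∀ n, Measurable (g n)) → (∀ᵐ x : ℝ, Tendsto (fun n ↦ g n x) atTop (𝓝 (u x))) →
      (∫⁻ x in Ioo 0 η, ENNReal.ofReal (8 * ((layerNegPart η u x).re * layerArchGlue a η u x))) ≤
        liminf (fun n ↦ 2 * ∫⁻ x in Ioi (0 : ℝ), ∫⁻ s in Ioi (0 : ℝ),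
          ENNReal.ofReal ((‖g n s‖ * ‖g n x‖ - (g n s * conj (g n x)).re) *
            (weilArchDensity |s - x| - weilArchDensity (x + s)))) atTop := by
  intro a η u g hη _hηa hu him _hsupp hsign hgm hlim
  -- name the gain integrands `Φ n x s`
  obtain ⟨Φ, hΦ⟩ : ∃ Φ : ℕ → ℝ → ℝ → ℝ≥0∞, ∀ n x s, Φ n x s = ENNReal.ofReal
      ((‖g n s‖ * ‖g n x‖ - (g n s * conj (g n x)).re) *
        (weilArchDensity |s - x| - weilArchDensity (x + s))) := ⟨_, fun _ _ _ ↦ rfl⟩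
  simp only [← hΦ]
  have hΦm : ∀ n, Measurable (Function.uncurry (Φ n)) := fun n ↦ by
    have h := measurable_gain (hgm n)
    simp only [← hΦ] at h
    exact h
  have hsymm : ∀ n x s, Φ n s x = Φ n x s := fun n x s ↦ by
    rw [hΦ, hΦ]
    exact gain_symm (g n) x s
  have hΨm : ∀ n, Measurable (Function.uncurry fun x s ↦ 2 * (Φ n x s + Φ n x s)) :=
    fun n ↦ ((hΦm n).add (hΦm n)).const_mul 2
  -- (1) geometry: twice the rectangle `(0,η) × (η,a)` inside the quadrant
  have key : ∀ n, ∫⁻ x in Ioo 0 η, ∫⁻ s in Ioo η a, 2 * (Φ n x s + Φ n x s) ≤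
      2 * ∫⁻ x in Ioi (0 : ℝ), ∫⁻ s in Ioi (0 : ℝ), Φ n x s := fun n ↦ by
    calc ∫⁻ x in Ioo 0 η, ∫⁻ s in Ioo η a, 2 * (Φ n x s + Φ n x s)
        = 2 * ∫⁻ x in Ioo 0 η, ∫⁻ s in Ioo η a, (Φ n x s + Φ n x s) := by
          rw [← lintegral_const_mul' _ _ ENNReal.ofNat_ne_top]
          exact lintegral_congr fun x ↦ lintegral_const_mul' _ _ ENNReal.ofNat_ne_top
      _ ≤ 2 * ∫⁻ x in Ioi (0 : ℝ), ∫⁻ s in Ioi (0 : ℝ), Φ n x s :=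
          mul_le_mul_right (setLIntegral_rect_add_le (hΦm n) (hsymm n) a hη) 2
  -- numerals
  have e4 : ∀ r : ℝ, (2 : ℝ≥0∞) * (ENNReal.ofReal r + ENNReal.ofReal r) = ENNReal.ofReal (4 * r) :=
    fun r ↦ by
      rw [ENNReal.ofReal_mul (by norm_num : (0 : ℝ) ≤ 4), ENNReal.ofReal_ofNat, ← two_mul,
        ← mul_assoc]
      norm_num
  -- (2) the a.e. limit on the rectangle, integrated in `s`
  have hae : ∀ᵐ x ∂(volume.restrict (Ioo 0 η)),
      ENNReal.ofReal (8 * ((layerNegPart η u x).re * layerArchGlue a η u x)) =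
        ∫⁻ s in Ioo η a, liminf (fun n ↦ 2 * (Φ n x s + Φ n x s)) atTop := by
    filter_upwards [ae_restrict_mem measurableSet_Ioo, ae_restrict_of_ae hlim] with x hx hxl
    have hw : (layerNegPart η u x).re = max (-(u x).re) 0 := by
      rw [layerNegPart_eq_of_mem hx, Complex.ofReal_re]
    symm
    calc ∫⁻ s in Ioo η a, liminf (fun n ↦ 2 * (Φ n x s + Φ n x s)) atTop
        = ∫⁻ s in Ioo η a, ENNReal.ofReal (8 * max (-(u x).re) 0) * ENNReal.ofReal
            ((u s).re * (weilArchDensity |s - x| - weilArchDensity (x + s))) := by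
          refine lintegral_congr_ae ?_
          filter_upwards [ae_restrict_mem measurableSet_Ioo, ae_restrict_of_ae hlim,
            ae_restrict_of_ae hsign] with s hs hsl hsg
          have hten : Tendsto (fun n ↦ 2 * (Φ n x s + Φ n x s)) atTop
              (𝓝 (2 * (ENNReal.ofReal ((‖u s‖ * ‖u x‖ - (u s * conj (u x)).re) *
                  (weilArchDensity |s - x| - weilArchDensity (x + s))) +
                ENNReal.ofReal ((‖u s‖ * ‖u x‖ - (u s * conj (u x)).re) *
                  (weilArchDensity |s - x| - weilArchDensity (x + s)))))) := by
            have h := tendsto_gain hxl hsl (weilArchDensity |s - x| - weilArchDensity (x + s))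
            simp only [← hΦ] at h
            exact ENNReal.Tendsto.const_mul (h.add h) (Or.inr ENNReal.ofNat_ne_top)
          rw [hten.liminf_eq, e4, delta_real (him s) (him x) (hsg (Ioo_subset_Ico_self hs)),
            ← ENNReal.ofReal_mul (p := 8 * max (-(u x).re) 0) (by positivity)]
          congr 1
          ring
      _ = ENNReal.ofReal (8 * max (-(u x).re) 0) * ∫⁻ s in Ioo η a, ENNReal.ofReal
            ((u s).re * (weilArchDensity |s - x| - weilArchDensity (x + s))) :=
          lintegral_const_mul' _ _ ENNReal.ofReal_ne_top
      _ = ENNReal.ofReal (8 * ((layerNegPart η u x).re * layerArchGlue a η u x)) := by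
          rw [setLIntegral_bulk_eq_glue hu hsign hx,
            ← ENNReal.ofReal_mul (p := 8 * max (-(u x).re) 0) (by positivity), hw, mul_assoc]
  -- (3) Fatou in `s`, Fatou in `x`, and the geometry
  calc ∫⁻ x in Ioo 0 η, ENNReal.ofReal (8 * ((layerNegPart η u x).re * layerArchGlue a η u x))
      = ∫⁻ x in Ioo 0 η, ∫⁻ s in Ioo η a, liminf (fun n ↦ 2 * (Φ n x s + Φ n x s)) atTop :=
        lintegral_congr_ae hae
    _ ≤ ∫⁻ x in Ioo 0 η, liminf (fun n ↦ ∫⁻ s in Ioo η a, 2 * (Φ n x s + Φ n x s)) atTop :=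
        lintegral_mono fun x ↦ lintegral_liminf_le fun n ↦ (hΨm n).comp measurable_prodMk_left
    _ ≤ liminf (fun n ↦ ∫⁻ x in Ioo 0 η, ∫⁻ s in Ioo η a, 2 * (Φ n x s + Φ n x s)) atTop :=
        lintegral_liminf_le fun n ↦
          (hΨm n).lintegral_prod_right' (ν := volume.restrict (Ioo η a))
    _ ≤ liminf (fun n ↦ 2 * ∫⁻ x in Ioi (0 : ℝ), ∫⁻ s in Ioi (0 : ℝ), Φ n x s) atTop :=
        liminf_le_liminf (Eventually.of_forall key)

end Summit.RiemannHypothesis.RiemannHypothesis.Theorems.OddSector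

end
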